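import Summits.NavierStokesRegularity.NavierStokesRegularity.Theorems.AdaptedFrequencyAdaptedKernelExistsLowerOfUpperBridge
import Literature.Analysis.FluidPDE.DriftHeatKernelWindow

/-!
# Crux `AdaptedKernelExists` (stmt-NavierStokesRegularity-2956), line `nash-entropy-last-block`:
  STUB `stub_lowerOfUpper` (Gaussian lower bound on the last block)

Helper file (lands `--supports stmt-NavierStokesRegularity-2956`) proving the registered stub
`stub_lowerOfUpper` of the line's skeleton: an adapted backward kernel `G` of `∂ₜ + b·∇ − νΔ` on
`Ico t₀ T` (pole `(T, x₀)`) of a Type-I drift `‖b(t, x)‖ ≤ C/√(T − t)` that obeys the Gaussian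
upper bound `G ≤ C₁ (T−t)^{-3/2} e^{−‖x−x₀‖²/(C₂(T−t))}` at interior times obeys the Gaussian lower
bound `c₁ (T−t)^{-3/2} e^{−‖x−x₀‖²/(c₂(T−t))} ≤ G` at interior times, with `c₁, c₂ > 0` depending
on `(ν, C, C₁, C₂)` only (Maekawa 2008, ARMA 189, Thm 1.1 is the printed statement; here ONE
Gaussian comparison on the last block `[t, t + (T−t)/2]`).

## Proof

The bridge and the comparison (`lowerOfUpper_bridge`, `lowerOfUpper_pointwise`) are in the
companion file `…LowerOfUpperBridge`. Here:

* `lowerOfUpper_mass`: unit mass and the upper bound at `t′ = t + h/2`, `h = T − t`, put mass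
  `≥ 1/2` of `G(t′, ·)` in `B̄(x₀, R√h)`, `R = R(C₁, C₂)` (Gaussian integral
  `∫ e^{−b‖v‖²} = (π/b)^{3/2}`, Mathlib `GaussianFourier.integral_rexp_neg_mul_sq_norm`);
* `lowerOfUpper_const`: all powers of `h` cancel in
  `½ kSubLow 3 (C/(ν√(h/2))) (‖x−x₀‖ + 2R√h) (νh/2)`, leaving the claim with `c₂ = 2ν/3`;
* `stub_lowerOfUpper`: the weight `φ = ψ · G(t′)` (`ψ` a bump of `B̄(x₀, R√h) ⊂ B̄(x₀, 2R√h)`)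
  in `lowerOfUpper_pointwise` on the block `[t, t′]` (drift bound `C/√(h/2)`).
-/

noncomputable section

open MeasureTheory Set Filter Topology Metric Function Real
open scoped Laplacian
open Literature.Analysis.FluidPDE

namespace Summit.NavierStokesRegularity.NavierStokesRegularity.Theorems.AdaptedKernelExists.NashEntropyLastBlock

/-! ### Mass in a ball and the constants (dimension three) -/

section Three

local notation "E3" => EuclideanSpace ℝ (Fin 3)

/-- **Mass of the bulk.** There is `R = R(C₁, C₂) > 0` such that every probability density `g`
on `ℝ³` below the Gaussian `C₁ (h/2)^{-3/2} e^{−‖z−x₀‖²/(C₂ h/2)}` has mass at least `1/2` in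
the ball `B̄(x₀, R√h)`: outside it `g ≤ C₁ (h/2)^{-3/2} e^{−R²/C₂} e^{−‖z−x₀‖²/(C₂h)}`, whose
integral `C₁ (2πC₂)^{3/2} e^{−R²/C₂}` (Gaussian integral) is `≤ 1/2` for
`R² = 2C₁C₂(2πC₂)^{3/2}`. -/
theorem lowerOfUpper_mass {C₁ C₂ : ℝ} (hC₁ : 0 < C₁) (hC₂ : 0 < C₂) :
    ∃ R : ℝ, 0 < R ∧ ∀ (h : ℝ), 0 < h → ∀ (x₀ : E3) (g : E3 → ℝ), Integrable g →
      ∫ z, g z = 1 → (∀ z, 0 ≤ g z) →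
      (∀ z, g z ≤ C₁ * (h / 2) ^ (-(3:ℝ) / 2) * Real.exp (-(‖z - x₀‖ ^ 2) / (C₂ * (h / 2)))) →
      1 / 2 ≤ ∫ z in closedBall x₀ (R * Real.sqrt h), g z := by
  obtain ⟨M, hM⟩ : ∃ M : ℝ, M = 2 * C₁ * (2 * π * C₂) ^ ((3:ℝ) / 2) := ⟨_, rfl⟩
  have hM0 : 0 < M := by rw [hM]; positivity
  refine ⟨Real.sqrt (C₂ * M), Real.sqrt_pos.2 (by positivity), fun h hh x₀ g hgi hg1 hg0 hgu => ?_⟩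
  obtain ⟨ρ, hρ⟩ : ∃ ρ : ℝ, ρ = Real.sqrt (C₂ * M) * Real.sqrt h := ⟨_, rfl⟩
  rw [← hρ]
  have hρ0 : 0 ≤ ρ := by rw [hρ]; positivity
  have hρ2 : ρ ^ 2 = C₂ * M * h := by
    rw [hρ, mul_pow, Real.sq_sqrt (by positivity), Real.sq_sqrt hh.le]
  obtain ⟨β, hβ⟩ : ∃ β : ℝ, β = 1 / (C₂ * h) := ⟨_, rfl⟩
  have hβ0 : 0 < β := by rw [hβ]; positivity
  -- the dominating Gaussian and its integral
  have hgauss : ∫ z : E3, Real.exp (-β * ‖z - x₀‖ ^ 2) = (π * C₂ * h) ^ ((3:ℝ) / 2) := by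
    rw [integral_sub_right_eq_self (fun v : E3 => Real.exp (-β * ‖v‖ ^ 2)) x₀,
      GaussianFourier.integral_rexp_neg_mul_sq_norm hβ0, finrank_euclideanSpace_fin, hβ]
    norm_num
    congr 1
    field_simp
  have hgi2 : Integrable fun z : E3 => Real.exp (-β * ‖z - x₀‖ ^ 2) := by
    by_contra hni
    rw [integral_undef hni] at hgauss
    exact (Real.rpow_pos_of_pos (by positivity) _).ne hgauss
  -- pointwise bound off the ball
  have htail_pt : ∀ z ∉ closedBall x₀ ρ,
      g z ≤ C₁ * (h / 2) ^ (-(3:ℝ) / 2) * Real.exp (-M) * Real.exp (-β * ‖z - x₀‖ ^ 2) := by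
    intro z hz
    have hz' : ρ ≤ ‖z - x₀‖ := by
      rw [mem_closedBall, dist_eq_norm, not_le] at hz
      exact hz.le
    have hρsq : ρ ^ 2 ≤ ‖z - x₀‖ ^ 2 := pow_le_pow_left₀ hρ0 hz' 2
    refine (hgu z).trans ?_
    have e1 : -(‖z - x₀‖ ^ 2) / (C₂ * (h / 2)) = -β * ‖z - x₀‖ ^ 2 + -β * ‖z - x₀‖ ^ 2 := by
      rw [hβ]; field_simp; ring
    have e2 : -β * ‖z - x₀‖ ^ 2 ≤ -M := by
      have : M = β * ρ ^ 2 := by rw [hρ2, hβ]; field_simp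
      rw [this, neg_mul, neg_le_neg_iff]
      exact mul_le_mul_of_nonneg_left hρsq hβ0.le
    rw [e1, Real.exp_add, ← mul_assoc]
    gcongr
  -- the exterior mass
  have hsplit := integral_add_compl (measurableSet_closedBall (x := x₀) (ε := ρ)) hgi
  rw [hg1] at hsplit
  have er : (h / 2) ^ (-(3:ℝ) / 2) * (π * C₂ * h) ^ ((3:ℝ) / 2) = (2 * π * C₂) ^ ((3:ℝ) / 2) := by
    have hne : (h / 2) ^ ((3:ℝ) / 2) ≠ 0 := (Real.rpow_pos_of_pos (by positivity) _).ne'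
    rw [show π * C₂ * h = (2 * π * C₂) * (h / 2) by ring,
      Real.mul_rpow (by positivity) (by positivity), show (-(3:ℝ) / 2) = -((3:ℝ) / 2) by ring,
      Real.rpow_neg (by positivity)]
    field_simp
  have hMe : M / 2 * Real.exp (-M) ≤ 1 / 2 := by
    have h1 : M ≤ Real.exp M := by linarith [Real.add_one_le_exp M]
    have h2 : M / Real.exp M ≤ 1 := (div_le_one (Real.exp_pos M)).2 h1
    rw [Real.exp_neg, show M / 2 * (Real.exp M)⁻¹ = M / Real.exp M / 2 by ring]
    linarith
  have htail : ∫ z in (closedBall x₀ ρ)ᶜ, g z ≤ 1 / 2 := by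
    calc ∫ z in (closedBall x₀ ρ)ᶜ, g z
        ≤ ∫ z in (closedBall x₀ ρ)ᶜ,
            C₁ * (h / 2) ^ (-(3:ℝ) / 2) * Real.exp (-M) * Real.exp (-β * ‖z - x₀‖ ^ 2) :=
          setIntegral_mono_on hgi.integrableOn (hgi2.const_mul _).integrableOn
            measurableSet_closedBall.compl fun z hz => htail_pt z hz
      _ ≤ ∫ z, C₁ * (h / 2) ^ (-(3:ℝ) / 2) * Real.exp (-M) * Real.exp (-β * ‖z - x₀‖ ^ 2) :=
          setIntegral_le_integral (hgi2.const_mul _) (Eventually.of_forall fun z => by positivity)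
      _ = C₁ * Real.exp (-M) * ((h / 2) ^ (-(3:ℝ) / 2) * (π * C₂ * h) ^ ((3:ℝ) / 2)) := by
          rw [integral_const_mul, hgauss]; ring
      _ = M / 2 * Real.exp (-M) := by rw [er, hM]; ring
      _ ≤ 1 / 2 := hMe
  linarith

/-- **The constants.** All powers of `h = T − t` cancel in the profile delivered by
`lowerOfUpper_pointwise` on the last block (drift bound `C/√(h/2)`, age `νh/2`, weight radius
`2R√h`): with `c₂ = 2ν/3` and `c₁ = ½ (2πν)^{-3/2} exp(−(9C/√ν + 4C²/ν + 6R²/ν))`,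
`c₁ h^{-3/2} e^{−r²/(c₂h)} ≤ ½ kSubLow 3 (C/(ν√(h/2))) (r + 2R√h) (νh/2)` (the tilt
`dkTilt` is absorbed by `A D ≤ D²/(8σ) + 2A²σ` and `(r + 2R√h)² ≤ 2r² + 8R²h`). -/
theorem lowerOfUpper_const {ν C R h : ℝ} (hν : 0 < ν) (hC : 0 ≤ C) (hR : 0 ≤ R) (hh : 0 < h)
    (r : ℝ) (hr : 0 ≤ r) :
    1 / 2 * (2 * π * ν) ^ (-(3:ℝ) / 2) *
        Real.exp (-(9 * C / Real.sqrt ν + 4 * C ^ 2 / ν + 6 * R ^ 2 / ν)) *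
      h ^ (-(3:ℝ) / 2) * Real.exp (-(r ^ 2) / (2 * ν / 3 * h)) ≤
    1 / 2 * kSubLow 3 (C / Real.sqrt (h / 2) / ν) (r + 2 * (R * Real.sqrt h)) (ν * (h / 2)) := by
  obtain ⟨w, hw, rfl⟩ : ∃ w, 0 < w ∧ ν = w ^ 2 :=
    ⟨Real.sqrt ν, Real.sqrt_pos.2 hν, (Real.sq_sqrt hν.le).symm⟩
  obtain ⟨u, hu, rfl⟩ : ∃ u, 0 < u ∧ h = 2 * u ^ 2 :=
    ⟨Real.sqrt (h / 2), Real.sqrt_pos.2 (half_pos hh), by rw [Real.sq_sqrt (half_pos hh).le]; ring⟩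
  have hw0 : w ≠ 0 := hw.ne'
  have hu0 : u ≠ 0 := hu.ne'
  have e1 : (2 : ℝ) * u ^ 2 / 2 = u ^ 2 := by ring
  have e2 : Real.sqrt (u ^ 2) = u := Real.sqrt_sq hu.le
  have e3 : Real.sqrt (w ^ 2) = w := Real.sqrt_sq hw.le
  have e4 : Real.sqrt (2 * u ^ 2) = Real.sqrt 2 * u := by rw [Real.sqrt_mul (by norm_num), e2]
  simp only [e1, e2, e3, e4]
  rw [kSubLow, dkTilt]
  obtain ⟨p, hp⟩ : ∃ p : ℝ, p = w ^ 2 * u ^ 2 := ⟨_, rfl⟩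
  obtain ⟨A, hA⟩ : ∃ A : ℝ, A = C / u / w ^ 2 := ⟨_, rfl⟩
  obtain ⟨D, hD⟩ : ∃ D : ℝ, D = r + 2 * (R * (Real.sqrt 2 * u)) := ⟨_, rfl⟩
  rw [← hp, ← hA, ← hD]
  have hp0 : 0 < p := by rw [hp]; positivity
  have hA0 : 0 ≤ A := by rw [hA]; positivity
  have hD0 : 0 ≤ D := by rw [hD]; positivity
  have e5 : Real.sqrt p = w * u := by
    rw [hp, show w ^ 2 * u ^ 2 = (w * u) ^ 2 by ring, Real.sqrt_sq (by positivity)]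
  obtain ⟨P, hP⟩ : ∃ P : ℝ, P = D ^ 2 / (8 * p) := ⟨_, rfl⟩
  obtain ⟨Q, hQ⟩ : ∃ Q : ℝ, Q = r ^ 2 / (8 * p) := ⟨_, rfl⟩
  -- the tilt
  have t1 : A * Real.sqrt (D ^ 2 + p) ≤ A * D + C / w := by
    have hs : Real.sqrt (D ^ 2 + p) ≤ D + w * u := by
      rw [Real.sqrt_le_left (by positivity), hp]
      nlinarith [mul_nonneg hD0 (mul_nonneg hw.le hu.le)]
    have hAwu : A * (w * u) = C / w := by rw [hA]; field_simp
    calc A * Real.sqrt (D ^ 2 + p) ≤ A * (D + w * u) := mul_le_mul_of_nonneg_left hs hA0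
      _ = A * D + C / w := by rw [mul_add, hAwu]
  have t2 : 2 * (3 + 1) * A * Real.sqrt p = 8 * (C / w) := by rw [e5, hA]; field_simp; ring
  have t3 : 2 * A ^ 2 * p = 2 * (C ^ 2 / w ^ 2) := by rw [hA, hp]; field_simp
  have t4 : A * D ≤ P + 2 * (C ^ 2 / w ^ 2) := by
    have : P + 2 * (C ^ 2 / w ^ 2) - A * D = (D - 4 * C * u) ^ 2 / (8 * p) := by
      rw [hP, hA, hp]; field_simp; ring
    have h0 : 0 ≤ (D - 4 * C * u) ^ 2 / (8 * p) := by positivity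
    linarith
  have t5 : P ≤ 2 * Q + 2 * (R ^ 2 / w ^ 2) := by
    have hD2 : D ^ 2 ≤ 2 * r ^ 2 + 16 * R ^ 2 * u ^ 2 := by
      have h2 : Real.sqrt 2 ^ 2 = 2 := Real.sq_sqrt (by norm_num)
      rw [hD]
      nlinarith [sq_nonneg (r - 2 * (R * (Real.sqrt 2 * u))), h2]
    have : 2 * Q + 2 * (R ^ 2 / w ^ 2) = (2 * r ^ 2 + 16 * R ^ 2 * u ^ 2) / (8 * p) := by
      rw [hQ, hp]; field_simp; ring
    rw [this, hP]
    exact div_le_div_of_nonneg_right hD2 (by positivity)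
  have eD : -D ^ 2 / (4 * p) = -(2 * P) := by rw [hP]; field_simp; ring
  have eQ : -r ^ 2 / (2 * w ^ 2 / 3 * (2 * u ^ 2)) = -(6 * Q) := by rw [hQ, hp]; field_simp; ring
  have eK : -(9 * C / w + 4 * C ^ 2 / w ^ 2 + 6 * R ^ 2 / w ^ 2) =
      -(9 * (C / w) + 4 * (C ^ 2 / w ^ 2) + 6 * (R ^ 2 / w ^ 2)) := by ring
  have epre : (2 * π * w ^ 2) ^ (-(3:ℝ) / 2) * (2 * u ^ 2) ^ (-(3:ℝ) / 2) =
      (4 * π * p) ^ (-(3:ℝ) / 2) := by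
    rw [← Real.mul_rpow (by positivity) (by positivity), hp]
    congr 1
    ring
  have hexp : -(9 * (C / w) + 4 * (C ^ 2 / w ^ 2) + 6 * (R ^ 2 / w ^ 2)) + -(6 * Q) ≤
      -(2 * P) + -(A * Real.sqrt (D ^ 2 + p) + 2 * (3 + 1) * A * Real.sqrt p + 2 * A ^ 2 * p) := by
    rw [t2, t3]
    linarith [t1, t4, t5]
  rw [eD, eQ, eK]
  calc 1 / 2 * (2 * π * w ^ 2) ^ (-(3:ℝ) / 2) *
        Real.exp (-(9 * (C / w) + 4 * (C ^ 2 / w ^ 2) + 6 * (R ^ 2 / w ^ 2))) *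
        (2 * u ^ 2) ^ (-(3:ℝ) / 2) * Real.exp (-(6 * Q))
      = 1 / 2 * (4 * π * p) ^ (-(3:ℝ) / 2) *
          Real.exp (-(9 * (C / w) + 4 * (C ^ 2 / w ^ 2) + 6 * (R ^ 2 / w ^ 2)) + -(6 * Q)) := by
        rw [Real.exp_add, ← epre]; ring
    _ ≤ 1 / 2 * (4 * π * p) ^ (-(3:ℝ) / 2) * Real.exp (-(2 * P) +
          -(A * Real.sqrt (D ^ 2 + p) + 2 * (3 + 1) * A * Real.sqrt p + 2 * A ^ 2 * p)) := by
        gcongr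
    _ = 1 / 2 * ((4 * π * p) ^ (-(3:ℝ) / 2) * Real.exp (-(2 * P)) *
          Real.exp (-(A * Real.sqrt (D ^ 2 + p) + 2 * (3 + 1) * A * Real.sqrt p +
            2 * A ^ 2 * p))) := by
        rw [Real.exp_add]; ring

/-! ### The stub -/

/-- **Stub 3 of line `nash-entropy-last-block` — Gaussian lower bound on the last block.**
There are `c₁, c₂ > 0` depending only on `(ν, C, C₁, C₂)` such that every adapted backward
kernel `G` on `Ico t₀ T` (pole `(T, x₀)`) of `∂ₜ + b·∇ − νΔ`, `b` a jointly smooth Type-I drift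
with constant `C`, obeying the Gaussian upper bound `(C₁, C₂)` on `Ioo t₀ T`, satisfies
`c₁ (T−t)^{-3/2} exp(−‖x−x₀‖²/(c₂(T−t))) ≤ G(t, x)` for all interior `t ∈ Ioo t₀ T`
(`c₂ = 2ν/3`). Proof: with `h = T − t`, `t′ = t + h/2`, the weight `φ = ψ · G(t′)` (`ψ` a bump of
`B̄(x₀, R√h) ⊂ B̄(x₀, 2R√h)`) has mass `≥ 1/2` (`lowerOfUpper_mass`), the comparison
`lowerOfUpper_pointwise` on the block `[t, t′]` (drift bound `C/√(h/2)`) gives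
`½ kSubLow 3 (C/(ν√(h/2))) (‖x−x₀‖ + 2R√h) (νh/2) ≤ G(t, x)`, and `lowerOfUpper_const` is the
claim. Uses positivity, `C²`, the adjoint equation at interior times, unit mass and the Type-I
rate on the last block; not `div b = 0`. (Maekawa 2008, ARMA 189, Thm 1.1 is the printed lower
bound; Aronson 1967 for bounded drifts.) -/
theorem stub_lowerOfUpper :
    ∀ (ν C C₁ C₂ : ℝ), 0 < ν → 0 ≤ C → 0 < C₁ → 0 < C₂ → ∃ c₁ c₂ : ℝ, 0 < c₁ ∧ 0 < c₂ ∧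
      ∀ (t₀ T : ℝ) (b : ℝ → EuclideanSpace ℝ (Fin 3) → EuclideanSpace ℝ (Fin 3))
        (x₀ : EuclideanSpace ℝ (Fin 3)) (G : ℝ → EuclideanSpace ℝ (Fin 3) → ℝ),
        t₀ < T →
        IsSmoothSpaceTimeOn (Ico t₀ T) b →
        (∀ t ∈ Ico t₀ T, VectorCalculus.IsDivFree (b t)) →
        (∀ t ∈ Ico t₀ T, ∀ x, ‖b t x‖ ≤ C / Real.sqrt (T - t)) →
        IsAdaptedBackwardKernel ν b (Ico t₀ T) T x₀ G →
        (∀ t ∈ Ioo t₀ T, ∀ x,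
          G t x ≤ C₁ * (T - t) ^ (-(3:ℝ) / 2) * Real.exp (-(‖x - x₀‖ ^ 2) / (C₂ * (T - t)))) →
        ∀ t ∈ Ioo t₀ T, ∀ x,
          c₁ * (T - t) ^ (-(3:ℝ) / 2) * Real.exp (-(‖x - x₀‖ ^ 2) / (c₂ * (T - t))) ≤ G t x := by
  intro ν C C₁ C₂ hν hC hC₁ hC₂
  obtain ⟨R, hR, hmass⟩ := lowerOfUpper_mass hC₁ hC₂
  refine ⟨1 / 2 * (2 * π * ν) ^ (-(3:ℝ) / 2) *
      Real.exp (-(9 * C / Real.sqrt ν + 4 * C ^ 2 / ν + 6 * R ^ 2 / ν)), 2 * ν / 3,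
    by positivity, by positivity, ?_⟩
  intro t₀ T b x₀ G _ hb _ hbd hG hup t ht x
  have hh : 0 < T - t := sub_pos.2 ht.2
  have hτ : 0 < (T - t) / 2 := half_pos hh
  have htT : t + (T - t) / 2 < T := by linarith
  have ht' : t + (T - t) / 2 ∈ Ioo t₀ T := ⟨by linarith [ht.1], htT⟩
  have ht'S : t + (T - t) / 2 ∈ Ico t₀ T := Ioo_subset_Ico_self ht'
  -- the drift bound on the last block
  have hB : ∀ s ∈ Icc t (t + (T - t) / 2), ∀ y, ‖b s y‖ ≤ C / Real.sqrt ((T - t) / 2) := by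
    intro s hs y
    have hsI : s ∈ Ico t₀ T := ⟨by linarith [ht.1, hs.1], by linarith [hs.2]⟩
    refine (hbd s hsI y).trans ?_
    exact div_le_div_of_nonneg_left hC (Real.sqrt_pos.2 hτ)
      (Real.sqrt_le_sqrt (by linarith [hs.2]))
  -- the weight
  have hρ0 : 0 < R * Real.sqrt (T - t) := mul_pos hR (Real.sqrt_pos.2 hh)
  let ψ : ContDiffBump x₀ := ⟨R * Real.sqrt (T - t), 2 * (R * Real.sqrt (T - t)), hρ0, by linarith⟩
  have hψs : tsupport (ψ : E3 → ℝ) = closedBall x₀ (2 * (R * Real.sqrt (T - t))) :=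
    ψ.tsupport_eq
  have hG0 : ∀ z, 0 ≤ G (t + (T - t) / 2) z := fun z => (hG.pos _ ht'S z).le
  obtain ⟨φ, hφ⟩ : ∃ φ : E3 → ℝ, φ = fun z => ψ z * G (t + (T - t) / 2) z := ⟨_, rfl⟩
  have hφc : Continuous φ := by
    rw [hφ]; exact ψ.continuous.mul (hG.contDiff_slice ht'S).continuous
  have h0 : ∀ z, 0 ≤ φ z := fun z => by rw [hφ]; exact mul_nonneg ψ.nonneg (hG0 z)
  have hφG : ∀ z, φ z ≤ G (t + (T - t) / 2) z := fun z => by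
    rw [hφ]
    calc ψ z * G (t + (T - t) / 2) z ≤ 1 * G (t + (T - t) / 2) z :=
          mul_le_mul_of_nonneg_right ψ.le_one (hG0 z)
      _ = G (t + (T - t) / 2) z := one_mul _
  have hsupp : tsupport φ ⊆ closedBall x₀ (2 * (R * Real.sqrt (T - t))) := by
    rw [← hψs, hφ]; exact tsupport_mul_subset_left
  -- mass of the weight
  have hm : 1 / 2 ≤ ∫ z, φ z := by
    have hup' : ∀ z, G (t + (T - t) / 2) z ≤ C₁ * ((T - t) / 2) ^ (-(3:ℝ) / 2) *
        Real.exp (-(‖z - x₀‖ ^ 2) / (C₂ * ((T - t) / 2))) := by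
      intro z
      have := hup _ ht' z
      rwa [show T - (t + (T - t) / 2) = (T - t) / 2 by ring] at this
    have h1 := hmass (T - t) hh x₀ (G (t + (T - t) / 2)) (hG.integrable ht'S)
      (hG.integral_eq_one _ ht'S) hG0 hup'
    have h2 : ∫ z in closedBall x₀ (R * Real.sqrt (T - t)), G (t + (T - t) / 2) z =
        ∫ z in closedBall x₀ (R * Real.sqrt (T - t)), φ z :=
      setIntegral_congr_fun measurableSet_closedBall fun z hz => by
        rw [hφ]
        simp only [ψ.one_of_mem_closedBall hz, one_mul]
    have hφi : Integrable φ := hφc.integrable_of_hasCompactSupport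
      ((isCompact_closedBall x₀ _).of_isClosed_subset (isClosed_tsupport φ) hsupp)
    have h3 : ∫ z in closedBall x₀ (R * Real.sqrt (T - t)), φ z ≤ ∫ z, φ z :=
      setIntegral_le_integral hφi (Eventually.of_forall h0)
    linarith
  -- comparison and constants
  have key := lowerOfUpper_pointwise hν ht.1 hτ htT hb hB (by positivity) hG hφc h0 hφG
    (by positivity) hsupp x
  simp only [finrank_euclideanSpace_fin, Nat.cast_ofNat] at key
  have hconst := lowerOfUpper_const hν hC hR.le hh ‖x - x₀‖ (norm_nonneg _)
  have hk : 0 < kSubLow 3 (C / Real.sqrt ((T - t) / 2) / ν)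
      (‖x - x₀‖ + 2 * (R * Real.sqrt (T - t))) (ν * ((T - t) / 2)) :=
    kSubLow_pos _ _ _ (by positivity)
  calc _ ≤ 1 / 2 * kSubLow 3 (C / Real.sqrt ((T - t) / 2) / ν)
        (‖x - x₀‖ + 2 * (R * Real.sqrt (T - t))) (ν * ((T - t) / 2)) := hconst
    _ ≤ (∫ z, φ z) * kSubLow 3 (C / Real.sqrt ((T - t) / 2) / ν)
        (‖x - x₀‖ + 2 * (R * Real.sqrt (T - t))) (ν * ((T - t) / 2)) :=
          mul_le_mul_of_nonneg_right hm hk.le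
    _ ≤ G t x := key

end Three

/-! ### Calibration: the model case `b ≡ 0` -/

section Calibration

/-- **Non-vacuity / calibration of `stub_lowerOfUpper` on the model case `b ≡ 0`** (registered
sub-goal `stub_lowerOfUpper_heatKernel`).  The zero drift
is smooth, divergence free and Type-I with constant `C = 0`, and the backward heat kernel
`Γ_{T,x₀}` is an adapted backward kernel of it on `Ico t₀ T` which attains the Gaussian upper
bound with `C₁ = (4πν)^{-3/2}`, `C₂ = 4ν`; hence `stub_lowerOfUpper` applies and yields constants
`c₁, c₂ > 0` (depending on `ν` only) with `c₁ (T−t)^{-3/2} e^{−‖x−x₀‖²/(c₂(T−t))} ≤ Γ_{T,x₀}(t,x)`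
for all `t ∈ Ioo t₀ T` — the hypotheses of the stub are consistent and its conclusion is the
expected heat-kernel lower bound up to constants. -/
theorem stub_lowerOfUpper_heatKernel :
    ∀ (ν : ℝ), 0 < ν → ∃ c₁ c₂ : ℝ, 0 < c₁ ∧ 0 < c₂ ∧
      ∀ (t₀ T : ℝ) (x₀ : EuclideanSpace ℝ (Fin 3)), t₀ < T → ∀ t ∈ Ioo t₀ T, ∀ x,
        c₁ * (T - t) ^ (-(3:ℝ) / 2) * Real.exp (-(‖x - x₀‖ ^ 2) / (c₂ * (T - t))) ≤
          backwardHeatKernel ν T x₀ t x := by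
  intro ν hν
  have hC₁ : 0 < (4 * Real.pi * ν) ^ (-(3:ℝ) / 2) := by positivity
  have hC₂ : 0 < 4 * ν := by positivity
  obtain ⟨c₁, c₂, hc₁, hc₂, hlow⟩ := stub_lowerOfUpper ν 0 _ _ hν le_rfl hC₁ hC₂
  refine ⟨c₁, c₂, hc₁, hc₂, fun t₀ T x₀ ht₀T => ?_⟩
  refine hlow t₀ T 0 x₀ (backwardHeatKernel ν T x₀) ht₀T contDiffOn_const
    (fun t _ x => by simp [VectorCalculus.divergence]) (fun t _ x => by simp)
    (isAdaptedBackwardKernel_backwardHeatKernel_Ico hν t₀ T x₀) (fun t ht x => ?_)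
  have h := backwardHeatKernel_eq hν.le x₀ ht.2 x
  rw [finrank_euclideanSpace_fin] at h
  rw [h]
  norm_num

end Calibration

end Summit.NavierStokesRegularity.NavierStokesRegularity.Theorems.AdaptedKernelExists.NashEntropyLastBlock

end
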